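import Summits.ResolutionOfSingularities.ResolutionOfSingularities.Theorems.PAlterationPialtAtomsOpenRange
import HarnessLib

/-!
# ResolutionOfSingularities / UniversalCells — crux `LocalToGlobal`, line `birth` (v3):
# two-model patching of proper models of transcendence degree `≤ n` from resolution of
# integral `k`-varieties of dimension `≤ n`

Crux `stmt-ResolutionOfSingularities-15232`, decl `UniversalCells.LocalToGlobal`, stub
`stub_twoModelPatchingAt_of_resolvable_dimLe` of the dimension-split line `birth` v3.

Let `k` be a field and `n : ℕ`. If every integral separated `k`-scheme of finite type of
(topological Krull) dimension `≤ n` has a resolution of singularities, then any two proper models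
`M₁`, `M₂` of a field extension `K/k` of transcendence degree `≤ n` are dominated by a proper
model `N` that is `RegLe` over both (Piltant's two-model patching, bounded by `trdeg`).

Proof: the join `J = M₁ ⋈ M₂` (`ProperModel.join`) is a proper model of `K/k`, so
`dim J = trdeg_k K ≤ n` (`Pialt.OpenRange.properModel_topologicalKrullDim_le_of_trdeg_le`); it is
integral and proper over `k`, hence resolvable by hypothesis; a resolution is a REGULAR proper
model dominating `J` (`ProperModel.exists_hom_isRegular_of_hasResolution`), and a regular model is
`RegLe` over every model it dominates. This is the argument of
`Pialt.OpenRange.twoModelPatching_of_trdeg_le_three` with `CossartPiltant2019` replaced by the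
dimension-bounded resolution hypothesis `hR`.

## References

* O. Zariski, P. Samuel, *Commutative Algebra* II, Ch. VI §17 (joins of models). [ZariskiSamuel1960]
-/

-- `Summit.<Summit>.<Sub>.Theorems` with `Sub = Summit` (single-conjunct summit, D-0017)
set_option linter.dupNamespace false

noncomputable section

open CategoryTheory AlgebraicGeometry
open Literature.AlgebraicGeometry.Resolution

namespace Summit.ResolutionOfSingularities.ResolutionOfSingularities.Theorems

/-- **Two-model patching of proper models in transcendence degree `≤ n` from resolution of
integral `k`-varieties of dimension `≤ n`.** If every integral separated finite-type `k`-scheme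
of dimension `≤ n` has a resolution of singularities, then for every field extension `K/k` with
`trdeg_k K ≤ n` any two proper models `M₁ M₂ : ProperModel k K` are dominated by a proper model
`N` with `N → M₁` and `N → M₂` both `RegLe`: resolve the join `M₁ ⋈ M₂`, a proper model of
dimension `trdeg_k K ≤ n`; the resolution is a regular proper model dominating both.
[cite: ZariskiSamuel1960, Ch. VI §17 (joins of models)] -/
theorem stub_twoModelPatchingAt_of_resolvable_dimLe (k : Type) [Field k] (n : ℕ)
    (hR : ∀ (X : Scheme.{0}) (f : X ⟶ Spec (.of k)), IsSeparated f → LocallyOfFiniteType f →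
      QuasiCompact f → IsIntegral X → topologicalKrullDim X ≤ n → Scheme.HasResolution X)
    (K : Type) [Field K] [Algebra k K] [Algebra.EssFiniteType k K]
    (hK : Algebra.trdeg k K ≤ n) (M₁ M₂ : ProperModel k K) :
    ∃ (N : ProperModel k K) (φ₁ : N.Hom M₁) (φ₂ : N.Hom M₂), φ₁.RegLe ∧ φ₂.RegLe := by
  let J := ProperModel.join M₁ M₂
  have hdim : topologicalKrullDim J.X ≤ n :=
    Pialt.OpenRange.properModel_topologicalKrullDim_le_of_trdeg_le J (d := n)
      (by exact_mod_cast hK)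
  have hres : Scheme.HasResolution J.X :=
    hR J.X J.π inferInstance inferInstance inferInstance inferInstance hdim
  obtain ⟨N, φ, hN⟩ := J.exists_hom_isRegular_of_hasResolution hres
  exact ⟨N, φ.comp (ProperModel.joinFst M₁ M₂), φ.comp (ProperModel.joinSnd M₁ M₂),
    fun y _ => hN y, fun y _ => hN y⟩

end Summit.ResolutionOfSingularities.ResolutionOfSingularities.Theorems

end
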